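import Summits.QuantumAdvantage.QuantumAdvantage.Theses.MobiusLadder
import Literature.NumberTheory.EllipticCurves.RootNumber

/-!
# Sketch — crux idea `selmer-parity-transfer` (crux stmt-QuantumAdvantage-1389 `LiouvilleNotPPoly`,
route MobiusLadder; crux-ideate round 1, ideator 2)

First lemmas of the line, stated over existing declarations (`WeierstrassCurve.rootNumber` of the
BSD prelude, `Literature.Computability.Complexity.PPoly`, Mathlib `ArithmeticFunction.liouville`,
`ArithmeticFunction.cardDistinctFactors`, `Squarefree`). Nothing here is proved except the trivial
promise-to-language glue; `HesseRootNumberFormula` is CHECKED NUMERICALLY (kit j016656: 0 mismatches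
on t ∈ [−3000,3000] and 200 random 60-bit t, against PARI `ellrootno`; conductor = rad(t(27t−1))).
-/

namespace Summit.QuantumAdvantage.QuantumAdvantage.Cruxes.LiouvilleNotPPoly.SelmerParityTransfer

open Literature.Computability.Complexity

/-- The `X₁(3)` family `E_t : y² + x·y + t·y = x³` (`a₁ = 1, a₃ = t`, all other `aᵢ = 0`);
`Δ(E_t) = t³ (1 − 27 t)`, `c₄ = 1 − 24 t`; semistable for every `t ≠ 0, 1/27`, split multiplicative
at every `p ∣ t`, multiplicative at `p ∣ 27t − 1` and split there iff `p ≡ 1 (mod 3)`. -/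
def hesse (t : ℕ) : WeierstrassCurve ℚ :=
  { a₁ := 1, a₂ := 0, a₃ := (t : ℚ), a₄ := 0, a₆ := 0 }

/-- `ω₁(m)`: the number of distinct prime factors of `m` that are `≡ 1 (mod 3)`. -/
def omegaOne (m : ℕ) : ℕ := (m.primeFactors.filter fun p => p % 3 = 1).card

/-- **K1** (first checkable lemma; Rohrlich 1993 Prop. 2(ii) + Tate's algorithm on the family,
`w_∞ = −1`): `w(E_t) = −(−1)^{ω(t)} · (−1)^{ω₁(27t−1)}` for every `t ≥ 1`.
In the tree: `rootNumber_eq_algebraicRootNumber` (named fact, hypothesis vacuous here since `E_t`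
is semistable), `localRootNumberAt_of_hasSplitMultiplicativeReductionAt`,
`localRootNumberAt_of_hasMultiplicativeReductionAt_of_not_split`. -/
def HesseRootNumberFormula : Prop :=
  ∀ t : ℕ, 1 ≤ t →
    (hesse t).rootNumber =
      -((-1 : ℤ) ^ ArithmeticFunction.cardDistinctFactors t) * (-1) ^ omegaOne (27 * t - 1)

/-- **K1a** (the provable local half of K1, size M/L: Tate's algorithm on the family — the model
`[1,0,t,0,0]` has `v_p(c₄) = 0 < v_p(Δ)` at every `p ∣ t(27t−1)`, so it is minimal and multiplicative
there; `−c₆ ≡ 1 (mod p)` at `p ∣ t` (split), `−c₆ ≡ −3/81 (mod p)` at `p ∣ 27t−1` (split iff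
`(−3/p) = 1` iff `p ≡ 1 (mod 3)`, and non-split at `p = 2`); then the prelude's `localRootNumberAt`
case list and `algebraicRootNumber = −∏ᶠ_v localRootNumberAt v`). No modularity input. -/
def HesseAlgebraicRootNumber : Prop :=
  ∀ t : ℕ, 1 ≤ t →
    (hesse t).algebraicRootNumber =
      -((-1 : ℤ) ^ ArithmeticFunction.cardDistinctFactors t) * (-1) ^ omegaOne (27 * t - 1)

/-- **K1b** (bridge through the tree's named fact `WeierstrassCurve.rootNumber_eq_algebraicRootNumber`,
Deligne 1973 / Rohrlich 1994 via modularity; its side condition "no additive reduction above 2, 3"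
is vacuous for the semistable `E_t`; `IsElliptic` since `Δ = t³(1−27t) ≠ 0` for `t ≥ 1`). -/
def HesseRootNumberBridge : Prop :=
  (∀ t : ℕ, 1 ≤ t → (hesse t).rootNumber_eq_algebraicRootNumber) →
    HesseAlgebraicRootNumber → HesseRootNumberFormula

/-- **K1′** (its squarefree specialisation: `27t − 1 ≡ 2 (mod 3)` forces an odd number of prime
factors `≡ 2 (mod 3)` counted with multiplicity, so on squarefree `27t−1`,
`(−1)^{ω₁(27t−1)} = −λ(27t−1)`, and `(−1)^{ω(t)} = λ(t)` on squarefree `t`):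
`w(E_t) = λ(t) · λ(27t − 1)` whenever `t (27t−1)` is squarefree. -/
def HesseRootNumberSqfree : Prop :=
  ∀ t : ℕ, 1 ≤ t → Squarefree (t * (27 * t - 1)) →
    (hesse t).rootNumber = ArithmeticFunction.liouville t * ArithmeticFunction.liouville (27 * t - 1)

/-- **C⁺ (apex of the transfer)**: no polynomial-size circuit family computes the global root
number (= sign of the functional equation of `L(E_t, s)`; = parity of the `p^∞`-Selmer corank by
Dokchitser–Dokchitser 2010 Thm 1.4; = parity of the Mordell–Weil rank under Ш finite) of `E_t` from
the binary digits of `t`, on the promise that `t(27t−1)` is squarefree. Hypothesis-type. -/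
def RootSignHard : Prop :=
  ¬ ∃ L ∈ PPoly, ∀ t : ℕ, 1 ≤ t → Squarefree (t * (27 * t - 1)) →
      (Computability.encodingNatBool.encode t ∈ L ↔ (hesse t).rootNumber = -1)

/-- `λ` is hard for `P/poly` already on the squarefree promise (a strengthening of the crux). -/
def LiouvilleSqfHard : Prop :=
  ¬ ∃ L ∈ PPoly, ∀ N : ℕ, 1 ≤ N → Squarefree N →
      (Computability.encodingNatBool.encode N ∈ L ↔ ArithmeticFunction.liouville N = -1)

/-- glue (trivial, proved): the promise version implies the crux BY NAME. -/
theorem liouvilleNotPPoly_of_sqfHard (h : LiouvilleSqfHard) :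
    Theses.MobiusLadder.LiouvilleNotPPoly := by
  intro hmem
  apply h
  refine ⟨_, hmem, fun N _ _ => ?_⟩
  simpa using (Computability.Encoding.mem_toLanguage_iff Computability.encodingNatBool
    {N : ℕ | ArithmeticFunction.liouville N = -1} N)

/-- **K2** (the transfer step, size M): the two-query reduction `w(E_t) = λ(t)·λ(27t−1)` on the
promise, plus closure of `PPoly` under the map `t ↦ 27t − 1` and under products of two `±1` answers
(tree: `mem_PPoly_of_polyTimeTuringReducible`, `inter_mem_PPoly`, `compl_mem_PPoly`). -/
theorem liouvilleSqfHard_of_rootSignHard :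
    HesseRootNumberSqfree → RootSignHard → LiouvilleSqfHard := by
  sorry

/-- Composition: the line concludes the crux by name from K1′ and the apex C⁺. -/
theorem LiouvilleNotPPoly_of (h₁ : HesseRootNumberSqfree) (h₂ : RootSignHard) :
    Theses.MobiusLadder.LiouvilleNotPPoly :=
  liouvilleNotPPoly_of_sqfHard (liouvilleSqfHard_of_rootSignHard h₁ h₂)

/-- **K3** (converse / corollary direction, size L): `λ|_{squarefree} ≤_R w(E_·)` — given `N`
squarefree, sample `r` uniformly WITH its factorisation (Kalai 2003), put `t = N·r` (squarefree iff
`gcd(r, N) = 1` and `r` squarefree — both checkable), query `w(E_t)`, and succeed when `27t − 1` is a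
prime times an `n^c`-smooth number (trial division + AKS), which happens with probability `≫ 1/n`
by quantitative Linnik for the progression `−1 (mod 27N)` once `r` has `≥ 5n` bits; amplify and
hard-wire the coins (Adleman). Gives `LiouvilleSqfHard → RootSignHard`, i.e. together with K2 the
EQUIVALENCE `RootSignHard ↔ LiouvilleSqfHard`. -/
def RootSignHardOfLiouville : Prop := LiouvilleSqfHard → RootSignHard

/-! ### In-Lean sanity checks (compute discipline: small cases in Lean, `native_decide`; evidence only) -/

/-- The right-hand side of K1 as a computable function. -/
def rhsK1 (t : ℕ) : ℤ :=
  -((-1 : ℤ) ^ ArithmeticFunction.cardDistinctFactors t) * (-1) ^ omegaOne (27 * t - 1)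

/-- PARI `ellrootno` values `w(E_t)`, `t = 1, …, 40` (kit job j016656, stdout table). -/
def pariW : List ℤ :=
  [1, 1, 1, 1, -1, 1, 1, -1, 1, -1, -1, 1, -1, 1, -1, 1, -1, 1, 1, 1,
   1, -1, -1, -1, -1, -1, 1, 1, 1, 1, -1, 1, -1, 1, -1, -1, -1, -1, -1, 1]

/-- K1's right-hand side reproduces PARI's analytic root numbers for `t ≤ 40`. -/
example : (List.range 40).map (fun i => rhsK1 (i + 1)) = pariW := by native_decide

/-- K1′ (the squarefree specialisation) agrees with K1 for all `t ≤ 400` on the promise: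
`−(−1)^{ω(t)}·(−1)^{ω₁(27t−1)} = λ(t)·λ(27t−1)` whenever `t(27t−1)` is squarefree. -/
example : ∀ t ∈ Finset.Icc 1 400, Squarefree (t * (27 * t - 1)) →
    rhsK1 t = ArithmeticFunction.liouville t * ArithmeticFunction.liouville (27 * t - 1) := by
  native_decide

/-- … and the promise is needed: at `t = 4` (`t` not squarefree) the two sides differ. -/
example : rhsK1 4 ≠ ArithmeticFunction.liouville 4 * ArithmeticFunction.liouville (27 * 4 - 1) := by
  native_decide

end Summit.QuantumAdvantage.QuantumAdvantage.Cruxes.LiouvilleNotPPoly.SelmerParityTransfer
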